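import Mathlib
import Summits.ValiantsHypothesis.ValiantsHypothesis.Theorems.NewtonUnitEquationsDissociatedUniformTotalsLawRigidPairs
import HarnessLib

/-!
# Crux `NewtonUnitEquations.DissociatedUniform` (stmt-ValiantsHypothesis-5905): three sampled circles with a MULTIPLIER on the third —
# the pointwise constant is governed by the resonance `2m + 1 ≡ 0 (mod q)`

Memo `Cruxes/DissociatedUniform/NOTES-t1g8.md` §2/§5(i), NOTES-d1g3 §3 (census families "circles with multipliers").  `…TotalsLawRigidPairs`
proved `V_s ≤ 3q` (dominant regime) for three sampled circles read co-rotating (`m = 1`, `3 ∈ (ℤ/q)ˣ`).  Here the third circle is read through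
an arbitrary UNIT multiplier `m`: `c z = trigCurve c₃ A₃ φ₃ (m z)` (so `m = −1` is the CONTRA-oriented circle, `|m| > 1` a regular star
polygon).  Turning the weight by one sampling step is now a label shift by `m⁻¹`, and the hit condition of the shear orbit `u` reads
`c (u − (2 + m⁻¹) x) ∈ Top(n_u)`, so each orbit contributes at most `2·K` hits, `K = #{x : (2m+1) x = 0}`:

* `card_commonTop_le_comp` / `card_commonDir_le_add_comp`: the cone sweep count and the reduction `#CommonDir ≤ q + #exposed edges` for a
  RELABELLED strictly convex polygon `c ∘ σ` (`σ` any permutation of the labels — weak tops only see the point set);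
* **`card_commonDir_trigMul_le : #CommonDir ≤ (1 + 2K) q`**, **`classVert_trigMul_smul_le : ∃ μ₀ ∀ μ ≥ μ₀ ∀ s, V_s(a, b, μ•c) ≤ (1 + 2K) q`**
  for `a, b` sampled circles (`A² ≠ B²`), `c = trigCurve c₃ A₃ φ₃ ∘ (m • ·)`, `m ∈ (ℤ/q)ˣ`, `A₃ ≠ 0`, `q ≥ 3`;
* `classVert_trigMul_smul_le_three_mul` (`2m + 1` a unit ⇒ `V_s ≤ 3q`; in particular **`classVert_trigNeg_smul_le`**: the contra-oriented
  circle `m = −1` gives `V_s ≤ 3q` for EVERY `q ≥ 3`), and `classVert_trig_smul_le'` (`m = 1`: `V_s ≤ (1 + 2·#{x : 3x = 0}) q`, no condition on `q`).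
RESONANCE (census of this seat, `exp/star_circle.py`, exact hulls, `μ = 10⁵`, `A = 1`, `B = 0.95`): for `q` odd and `m = (q−1)/2`
(`2m + 1 = q ≡ 0`, `K = q`, the bound is vacuous) one class has `35, 77, 104, 153 = 0.71, 0.64, 0.62, 0.53 q²` vertices at
`q = 7, 11, 13, 17` while `T = 2q²` (`2q² + q` at `q = 17`): a pointwise counterexample family made of three sampled CIRCLES (the fibres
co-rotate with the position on the big star polygon, so every blob exposes the `≈ q/2` clustered normals of its thin ellipse).
Honest label: a pointwise law on a named family in the dominant regime; `CoOrientedClassBound`, `SmoothSharpTotalsLaw`, `TotalsLawThree`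
remain OPEN; nothing here bears on VP ≠ VNP.
[folklore]
-/

set_option linter.dupNamespace false -- `ValiantsHypothesis.ValiantsHypothesis` (summit = problem) in every name

open scoped BigOperators

namespace Summit.ValiantsHypothesis.ValiantsHypothesis.Theorems.NewtonUnitEquationsDissociatedUniform

namespace TotalsLaw

open Matrix Real

section CircleMultipliers

variable {q : ℕ} [NeZero q]

/-! #### Relabelled strictly convex polygons -/

omit [NeZero q] in
/-- Weak tops of a relabelled curve. [folklore] -/
theorem wTop_comp_equiv (c : ZMod q → (Fin 2 → ℝ)) (σ : ZMod q ≃ ZMod q) (θ : Fin 2 → ℝ) (z : ZMod q) :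
    WTop (c ∘ σ) θ z ↔ WTop c θ (σ z) := by
  constructor
  · intro h w
    have := h (σ.symm w)
    simpa using this
  · intro h w
    exact h (σ w)

open scoped Classical in
/-- The cone sweep count for a RELABELLED strictly convex ccw polygon `c ∘ σ`. [folklore] -/
theorem card_commonTop_le_comp {c : ZMod q → (Fin 2 → ℝ)} (hc : StrictlyConvexCcw c) (hq : 3 ≤ q) (σ : ZMod q ≃ ZMod q)
    {P : ZMod q → (Fin 2 → ℝ)} (hP : SharpTops P) (z : ZMod q) :
    (Finset.univ.filter fun x : ZMod q => ∃ θ : Fin 2 → ℝ, θ ≠ 0 ∧ WTop (c ∘ σ) θ z ∧ WTop P θ x).card ≤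
      1 + (Finset.univ.filter fun x : ZMod q =>
        ∃ θ : Fin 2 → ℝ, θ ≠ 0 ∧ WTop (c ∘ σ) θ z ∧ WTop P θ x ∧ WTop P θ (x + 1)).card := by
  simp only [wTop_comp_equiv]
  exact card_commonTop_le hc hq hP (σ z)

open scoped Classical in
/-- `#{CommonDir} ≤ q + #{exposed edges}` for a relabelled strictly convex ccw third polygon. [folklore] -/
theorem card_commonDir_le_add_comp (a b : ZMod q → (Fin 2 → ℝ)) {c : ZMod q → (Fin 2 → ℝ)} (hc : StrictlyConvexCcw c) (hq : 3 ≤ q)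
    (σ : ZMod q ≃ ZMod q) (s : ZMod q) (hP : ∀ z, SharpTops (bpt a b s z)) :
    (Finset.univ.filter fun zx : ZMod q × ZMod q => CommonDir a b (c ∘ σ) s zx.1 zx.2).card ≤
      q + (Finset.univ.filter fun zx : ZMod q × ZMod q => EdgeHit a b (c ∘ σ) s zx.1 zx.2).card := by
  rw [card_filter_prod_eq_sum, card_filter_prod_eq_sum]
  calc ∑ z : ZMod q, (Finset.univ.filter fun x => CommonDir a b (c ∘ σ) s z x).card
      ≤ ∑ z : ZMod q, (1 + (Finset.univ.filter fun x => EdgeHit a b (c ∘ σ) s z x).card) :=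
        Finset.sum_le_sum fun z _ => card_commonTop_le_comp hc hq σ (hP z) z
    _ = q + ∑ z : ZMod q, (Finset.univ.filter fun x => EdgeHit a b (c ∘ σ) s z x).card := by
        rw [Finset.sum_add_distrib, Finset.sum_const, Finset.card_univ, ZMod.card, smul_eq_mul, mul_one]

/-! #### The circle read through a unit multiplier -/

/-- The sampled circle read through the unit multiplier `m`: `z ↦ trigCurve c₃ A₃ φ₃ (m z)`. -/
noncomputable def trigMul (c₃ : Fin 2 → ℝ) (A₃ φ₃ : ℝ) (m : (ZMod q)ˣ) : ZMod q → (Fin 2 → ℝ) :=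
  fun z => trigCurve c₃ A₃ φ₃ ((m : ZMod q) * z)

omit [NeZero q] in
/-- `trigMul` is the circle relabelled by the permutation `z ↦ m z`. [folklore] -/
theorem trigMul_eq_comp (c₃ : Fin 2 → ℝ) (A₃ φ₃ : ℝ) (m : (ZMod q)ˣ) :
    trigMul c₃ A₃ φ₃ m = trigCurve c₃ A₃ φ₃ ∘ (m.mulLeft : ZMod q ≃ ZMod q) := by
  funext z; rfl

/-- Turning the weight by `x` sampling steps is the label shift `m⁻¹ x` on the multiplied circle. [folklore] -/
theorem wTop_trigMul_rot (c₃ : Fin 2 → ℝ) (A₃ φ₃ : ℝ) (m : (ZMod q)ˣ) (θ : Fin 2 → ℝ) (x w : ZMod q) :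
    WTop (trigMul c₃ A₃ φ₃ m) (rot (2 * π * (x.val : ℝ) / q) θ) ((m⁻¹ : (ZMod q)ˣ) * x + w) ↔ WTop (trigMul c₃ A₃ φ₃ m) θ w := by
  have h : ∀ w' : ZMod q, trigMul c₃ A₃ φ₃ m (((m⁻¹ : (ZMod q)ˣ) : ZMod q) * x + w') =
      c₃ + rot (2 * π * (x.val : ℝ) / q) (trigMul c₃ A₃ φ₃ m w' - c₃) := by
    intro w'
    have e : (m : ZMod q) * (((m⁻¹ : (ZMod q)ˣ) : ZMod q) * x + w') = (m : ZMod q) * w' + x := by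
      rw [mul_add, ← mul_assoc, Units.mul_inv, one_mul, add_comm]
    simp only [trigMul]
    rw [e]
    exact trigCurve_add_eq_rot c₃ A₃ φ₃ ((m : ZMod q) * w') x
  exact wTop_rot_shift h θ w

/-- The fibres of a translation-and-scaling `x ↦ u − λ x` are no larger than the kernel of `λ`. [folklore] -/
theorem card_filter_sub_mul_eq_le (lam u w : ZMod q) [DecidableEq (ZMod q)] :
    (Finset.univ.filter fun x : ZMod q => u - lam * x = w).card ≤ (Finset.univ.filter fun x : ZMod q => lam * x = 0).card := by
  by_cases hne : (Finset.univ.filter fun x : ZMod q => u - lam * x = w).Nonempty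
  · obtain ⟨x₀, hx₀⟩ := hne
    have hx₀' : u - lam * x₀ = w := (Finset.mem_filter.1 hx₀).2
    refine Finset.card_le_card_of_injOn (fun x => x - x₀) (fun x hx => ?_) ?_
    · have hx' : u - lam * x = w := (Finset.mem_filter.1 hx).2
      simp only [Finset.coe_filter, Finset.mem_univ, true_and, Set.mem_setOf_eq]
      rw [mul_sub]; linear_combination hx₀' - hx'
    · intro x _ x' _ h
      simpa using h
  · rw [Finset.not_nonempty_iff_eq_empty.1 hne, Finset.card_empty]; exact Nat.zero_le _

open scoped Classical in
/-- Variant of `card_wTop_exposing_le_two` needing only "no three weak tops" for `c` (relabelled polygons lose label-adjacency but keep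
this). [folklore] -/
theorem card_wTop_exposing_le_two' {c : ZMod q → (Fin 2 → ℝ)}
    (hc : ∀ θ : Fin 2 → ℝ, θ ≠ 0 → ∀ x y w : ZMod q, WTop c θ x → WTop c θ y → WTop c θ w → x = y ∨ y = w ∨ x = w)
    {P : ZMod q → (Fin 2 → ℝ)} (hP : SharpTops P) (hq : 3 ≤ q) (h01 : P 1 ≠ P 0) :
    (Finset.univ.filter fun w : ZMod q =>
      ∃ θ : Fin 2 → ℝ, θ ≠ 0 ∧ WTop c θ w ∧ WTop P θ 0 ∧ WTop P θ 1).card ≤ 2 := by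
  by_contra hgt
  obtain ⟨u, hu, v, hv, w, hw, huv, huw, hvw⟩ := Finset.two_lt_card.1 (not_le.1 hgt)
  simp only [Finset.mem_filter, Finset.mem_univ, true_and] at hu hv hw
  obtain ⟨θ, hθ, hcu, hu0, hu1⟩ := hu
  obtain ⟨θv, hθv, hcv, hv0, hv1⟩ := hv
  obtain ⟨θw, hθw, hcw, hw0, hw1⟩ := hw
  obtain ⟨tv, htv, rfl⟩ := exposing_unique hP hq h01 hθ hθv hu0 hu1 hv0 hv1
  obtain ⟨tw, htw, rfl⟩ := exposing_unique hP hq h01 hθ hθw hu0 hu1 hw0 hw1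
  rw [wTop_smul_iff c htv] at hcv
  rw [wTop_smul_iff c htw] at hcw
  rcases hc θ hθ u v w hcu hcv hcw with h | h | h
  · exact huv h
  · exact hvw h
  · exact huw h

open scoped Classical in
/-- **`#CommonDir ≤ (1 + 2K) q` for three sampled circles, the third read through the unit multiplier `m`**, `K = #{x : (2m+1) x = 0}`
(`B² < A²`, `A₃ ≠ 0`, `q ≥ 3`). [folklore] -/
theorem card_commonDir_trigMul_le (hq : 3 ≤ q) (m : (ZMod q)ˣ) (c₁ c₂ c₃ : Fin 2 → ℝ) {A B A₃ : ℝ}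
    (hAB : B ^ 2 < A ^ 2) (hA₃ : A₃ ≠ 0) (φ ψ φ₃ : ℝ) (s : ZMod q) :
    (Finset.univ.filter fun zx : ZMod q × ZMod q =>
      CommonDir (trigCurve c₁ A φ) (trigCurve c₂ B ψ) (trigMul c₃ A₃ φ₃ m) s zx.1 zx.2).card ≤
      (1 + 2 * (Finset.univ.filter fun x : ZMod q => (2 * (m : ZMod q) + 1) * x = 0).card) * q := by
  set a := trigCurve (q := q) c₁ A φ with ha
  set b := trigCurve (q := q) c₂ B ψ with hb
  set c := trigMul (q := q) c₃ A₃ φ₃ m with hcdef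
  set K := (Finset.univ.filter fun x : ZMod q => (2 * (m : ZMod q) + 1) * x = 0).card with hK
  have hc0 : StrictlyConvexCcw (trigCurve (q := q) c₃ A₃ φ₃) := strictlyConvexCcw_trigCurve hq c₃ hA₃ φ₃
  have hc3 : ∀ θ : Fin 2 → ℝ, θ ≠ 0 → ∀ x y w : ZMod q, WTop c θ x → WTop c θ y → WTop c θ w → x = y ∨ y = w ∨ x = w := by
    intro θ hθ x y w hx hy hw
    have h := sharpTops_of_strictlyConvexCcw hc0 hq θ hθ
    rw [hcdef, trigMul_eq_comp, wTop_comp_equiv] at hx hy hw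
    rcases h.2 _ _ _ hx hy hw with e | e | e
    · left; exact m.mulLeft.injective e
    · right; left; exact m.mulLeft.injective e
    · right; right; exact m.mulLeft.injective e
  have hPconv : ∀ z, StrictlyConvexCcw (bpt a b s z) := fun z => strictlyConvexCcw_bpt_trigCurve hq c₁ c₂ hAB φ ψ s z
  have hP : ∀ z, SharpTops (bpt a b s z) := fun z => sharpTops_of_strictlyConvexCcw (hPconv z) hq
  have hab : RigidPair a b (c₁ + c₂) := rigidPair_trigCurve c₁ c₂ A B φ ψ
  have h01 : ∀ u, bpt a b s u 1 ≠ bpt a b s u 0 := fun u => by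
    have := (hPconv u).succ_ne hq 0
    rwa [zero_add] at this
  -- the multiplier of the hit condition
  set lam : ZMod q := 2 + ((m⁻¹ : (ZMod q)ˣ) : ZMod q) with hlam
  set CE : ZMod q → ZMod q → Prop := fun u w =>
    ∃ θ : Fin 2 → ℝ, θ ≠ 0 ∧ WTop c θ w ∧ WTop (bpt a b s u) θ 0 ∧ WTop (bpt a b s u) θ 1 with hCE
  have hiff : ∀ ux : ZMod q × ZMod q, (∃ θ : Fin 2 → ℝ, θ ≠ 0 ∧
      WTop c (rot (2 * π * (ux.2.val : ℝ) / q) θ) (ux.1 - 2 * ux.2) ∧ WTop (bpt a b s ux.1) θ 0 ∧ WTop (bpt a b s ux.1) θ 1) ↔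
      CE ux.1 (ux.1 - lam * ux.2) := by
    intro ux
    have e : ux.1 - 2 * ux.2 = ((m⁻¹ : (ZMod q)ˣ) : ZMod q) * ux.2 + (ux.1 - lam * ux.2) := by rw [hlam]; ring
    simp only [hCE, e, hcdef, wTop_trigMul_rot]
  have h1 : (Finset.univ.filter fun zx : ZMod q × ZMod q => EdgeHit a b c s zx.1 zx.2).card =
      (Finset.univ.filter fun ux : ZMod q × ZMod q => CE ux.1 (ux.1 - lam * ux.2)).card := by
    rw [card_edgeHit_eq_of_rigid hab c s]
    exact congrArg Finset.card (Finset.filter_congr fun ux _ => hiff ux)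
  -- the kernel of `lam` is the kernel of `2m + 1`
  have hker : (Finset.univ.filter fun x : ZMod q => lam * x = 0).card = K := by
    rw [hK]
    refine congrArg Finset.card (Finset.filter_congr fun x _ => ?_)
    rw [hlam]
    have hmi : ((m⁻¹ : (ZMod q)ˣ) : ZMod q) * (m : ZMod q) = 1 := Units.inv_mul m
    have him : (m : ZMod q) * ((m⁻¹ : (ZMod q)ˣ) : ZMod q) = 1 := Units.mul_inv m
    constructor
    · intro h
      linear_combination (m : ZMod q) * h - x * him
    · intro h
      linear_combination ((m⁻¹ : (ZMod q)ˣ) : ZMod q) * h - 2 * x * hmi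
  -- per `u`: at most `2K`
  have hper_u : ∀ u : ZMod q, (Finset.univ.filter fun x : ZMod q => CE u (u - lam * x)).card ≤ K * 2 := by
    intro u
    refine Finset.card_le_mul_card_image_of_maps_to (f := fun x : ZMod q => u - lam * x)
      (t := Finset.univ.filter fun w : ZMod q => CE u w) (fun x hx => ?_) K (fun w _ => ?_) |>.trans ?_
    · simp only [Finset.mem_filter, Finset.mem_univ, true_and] at hx ⊢; exact hx
    · refine le_trans (Finset.card_le_card ?_) ((card_filter_sub_mul_eq_le lam u w).trans (le_of_eq hker))
      intro x hx
      simp only [Finset.mem_filter, Finset.mem_univ, true_and] at hx ⊢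
      exact hx.2
    · exact Nat.mul_le_mul_left K (card_wTop_exposing_le_two' hc3 (hP u) hq (h01 u))
  have h2 : (Finset.univ.filter fun ux : ZMod q × ZMod q => CE ux.1 (ux.1 - lam * ux.2)).card ≤ 2 * K * q := by
    rw [card_filter_prod_eq_sum]
    calc ∑ u : ZMod q, (Finset.univ.filter fun x => CE u (u - lam * x)).card ≤ ∑ u : ZMod q, K * 2 :=
          Finset.sum_le_sum fun u _ => hper_u u
      _ = 2 * K * q := by rw [Finset.sum_const, Finset.card_univ, ZMod.card, smul_eq_mul]; ring
  have hmain := card_commonDir_le_add_comp a b hc0 hq (m.mulLeft : ZMod q ≃ ZMod q) s hP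
  rw [← trigMul_eq_comp, ← hcdef] at hmain
  calc (Finset.univ.filter fun zx : ZMod q × ZMod q => CommonDir a b c s zx.1 zx.2).card
      ≤ q + (Finset.univ.filter fun zx : ZMod q × ZMod q => EdgeHit a b c s zx.1 zx.2).card := hmain
    _ ≤ q + 2 * K * q := by rw [h1]; exact Nat.add_le_add_left h2 q
    _ = (1 + 2 * K) * q := by ring

open scoped Classical in
/-- **THE MULTIPLIER LAW, one class**: `a, b` sampled circles (`A² ≠ B²`), `c` a sampled circle read through a unit multiplier `m` (`A₃ ≠ 0`,
`q ≥ 3`): `V_s(a, b, μ•c) ≤ (1 + 2K) q` for `μ ≥ μ₀(s)`, `K = #{x : (2m+1) x = 0}`. [folklore] -/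
theorem classVert_trigMul_smul_le_of_class (hq : 3 ≤ q) (m : (ZMod q)ˣ) (c₁ c₂ c₃ : Fin 2 → ℝ) {A B A₃ : ℝ}
    (hAB : A ^ 2 ≠ B ^ 2) (hA₃ : A₃ ≠ 0) (φ ψ φ₃ : ℝ) (s : ZMod q) :
    ∃ μ₀ : ℝ, ∀ μ : ℝ, μ₀ ≤ μ → classVert (trigCurve c₁ A φ) (trigCurve c₂ B ψ) (μ • trigMul c₃ A₃ φ₃ m) s ≤
      (1 + 2 * (Finset.univ.filter fun x : ZMod q => (2 * (m : ZMod q) + 1) * x = 0).card) * q := by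
  rcases lt_or_gt_of_ne hAB with hlt | hgt
  · obtain ⟨μ₀, hμ₀⟩ := classVert_smul_le_card_commonDir (trigCurve (q := q) c₂ B ψ) (trigCurve c₁ A φ) (trigMul c₃ A₃ φ₃ m) s
    refine ⟨μ₀, fun μ hμ => ?_⟩
    rw [classVert_swap]
    exact (hμ₀ μ hμ).trans (card_commonDir_trigMul_le hq m c₂ c₁ c₃ hlt hA₃ ψ φ φ₃ s)
  · obtain ⟨μ₀, hμ₀⟩ := classVert_smul_le_card_commonDir (trigCurve (q := q) c₁ A φ) (trigCurve c₂ B ψ) (trigMul c₃ A₃ φ₃ m) s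
    exact ⟨μ₀, fun μ hμ => (hμ₀ μ hμ).trans (card_commonDir_trigMul_le hq m c₁ c₂ c₃ hgt hA₃ φ ψ φ₃ s)⟩

open scoped Classical in
/-- **THE MULTIPLIER LAW** (dominant regime, all classes): `∃ μ₀, ∀ μ ≥ μ₀, ∀ s, V_s(a, b, μ•c) ≤ (1 + 2·#{x : (2m+1) x = 0})·q`. [folklore] -/
theorem classVert_trigMul_smul_le (hq : 3 ≤ q) (m : (ZMod q)ˣ) (c₁ c₂ c₃ : Fin 2 → ℝ) {A B A₃ : ℝ}
    (hAB : A ^ 2 ≠ B ^ 2) (hA₃ : A₃ ≠ 0) (φ ψ φ₃ : ℝ) :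
    ∃ μ₀ : ℝ, ∀ μ : ℝ, μ₀ ≤ μ → ∀ s : ZMod q,
      classVert (trigCurve c₁ A φ) (trigCurve c₂ B ψ) (μ • trigMul c₃ A₃ φ₃ m) s ≤
        (1 + 2 * (Finset.univ.filter fun x : ZMod q => (2 * (m : ZMod q) + 1) * x = 0).card) * q := by
  choose f hf using fun s => classVert_trigMul_smul_le_of_class hq m c₁ c₂ c₃ hAB hA₃ φ ψ φ₃ s
  refine ⟨Finset.univ.sup' Finset.univ_nonempty f, fun μ hμ s => hf s μ ?_⟩
  exact (Finset.le_sup' f (Finset.mem_univ s)).trans hμ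

open scoped Classical in
/-- If `2m + 1` is a unit its kernel is trivial. [folklore] -/
theorem card_ker_eq_one_of_isUnit {lam : ZMod q} (h : IsUnit lam) :
    (Finset.univ.filter fun x : ZMod q => lam * x = 0).card = 1 := by
  rw [Finset.card_eq_one]
  refine ⟨0, Finset.ext fun x => ?_⟩
  simp only [Finset.mem_filter, Finset.mem_univ, true_and, Finset.mem_singleton]
  constructor
  · intro hx
    exact h.mul_left_cancel (by rw [hx, mul_zero])
  · rintro rfl; rw [mul_zero]

/-- **Non-resonant multipliers**: `2m + 1 ∈ (ℤ/q)ˣ` ⇒ `V_s(a, b, μ•c) ≤ 3q` in the dominant regime. [folklore] -/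
theorem classVert_trigMul_smul_le_three_mul (hq : 3 ≤ q) (m : (ZMod q)ˣ) (hm : IsUnit (2 * (m : ZMod q) + 1))
    (c₁ c₂ c₃ : Fin 2 → ℝ) {A B A₃ : ℝ} (hAB : A ^ 2 ≠ B ^ 2) (hA₃ : A₃ ≠ 0) (φ ψ φ₃ : ℝ) :
    ∃ μ₀ : ℝ, ∀ μ : ℝ, μ₀ ≤ μ → ∀ s : ZMod q,
      classVert (trigCurve c₁ A φ) (trigCurve c₂ B ψ) (μ • trigMul c₃ A₃ φ₃ m) s ≤ 3 * q := by
  classical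
  obtain ⟨μ₀, h⟩ := classVert_trigMul_smul_le hq m c₁ c₂ c₃ hAB hA₃ φ ψ φ₃
  refine ⟨μ₀, fun μ hμ s => (h μ hμ s).trans (le_of_eq ?_)⟩
  rw [card_ker_eq_one_of_isUnit hm]

/-- **The CONTRA-ORIENTED circle** (`m = −1`, the third circle traversed clockwise): `V_s(a, b, μ•c) ≤ 3q` for EVERY `q ≥ 3` — over a rigid
pair the orientation of a REGULAR third polygon is harmless (contrast the clockwise FAN of `…SmoothPointwise`). [folklore] -/
theorem classVert_trigNeg_smul_le (hq : 3 ≤ q) (c₁ c₂ c₃ : Fin 2 → ℝ) {A B A₃ : ℝ} (hAB : A ^ 2 ≠ B ^ 2) (hA₃ : A₃ ≠ 0)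
    (φ ψ φ₃ : ℝ) :
    ∃ μ₀ : ℝ, ∀ μ : ℝ, μ₀ ≤ μ → ∀ s : ZMod q,
      classVert (trigCurve c₁ A φ) (trigCurve c₂ B ψ) (μ • fun z => trigCurve c₃ A₃ φ₃ (-z)) s ≤ 3 * q := by
  have h := classVert_trigMul_smul_le_three_mul hq (-1) (by push_cast; norm_num) c₁ c₂ c₃ hAB hA₃ φ ψ φ₃
  have e : (trigMul (q := q) c₃ A₃ φ₃ (-1)) = fun z => trigCurve c₃ A₃ φ₃ (-z) := by
    funext z; simp [trigMul]
  rwa [e] at h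

open scoped Classical in
/-- The co-rotating circle (`m = 1`) without any condition on `q`: `V_s ≤ (1 + 2·#{x : 3x = 0})·q` (`= 3q` if `3 ∤ q`, `7q` if `3 ∣ q`).
[folklore] -/
theorem classVert_trig_smul_le' (hq : 3 ≤ q) (c₁ c₂ c₃ : Fin 2 → ℝ) {A B A₃ : ℝ} (hAB : A ^ 2 ≠ B ^ 2) (hA₃ : A₃ ≠ 0)
    (φ ψ φ₃ : ℝ) :
    ∃ μ₀ : ℝ, ∀ μ : ℝ, μ₀ ≤ μ → ∀ s : ZMod q,
      classVert (trigCurve c₁ A φ) (trigCurve c₂ B ψ) (μ • trigCurve c₃ A₃ φ₃) s ≤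
        (1 + 2 * (Finset.univ.filter fun x : ZMod q => (3 : ZMod q) * x = 0).card) * q := by
  have h := classVert_trigMul_smul_le hq 1 c₁ c₂ c₃ hAB hA₃ φ ψ φ₃
  have e : (trigMul (q := q) c₃ A₃ φ₃ 1) = trigCurve c₃ A₃ φ₃ := by
    funext z; simp [trigMul]
  have e3 : (2 * ((1 : (ZMod q)ˣ) : ZMod q) + 1) = 3 := by push_cast; norm_num
  rwa [e, e3] at h

end CircleMultipliers

end TotalsLaw

end Summit.ValiantsHypothesis.ValiantsHypothesis.Theorems.NewtonUnitEquationsDissociatedUniform
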